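import Literature.AlgebraicGeometry.Motives.AbelianVarietyTranslation
import Literature.AlgebraicGeometry.Motives.ComplexPointsZariskiDense
import HarnessLib

/-!
# A subgroup of `A(ℂ)` containing the complex points of a non-empty Zariski-open subset is all of `A(ℂ)`

Layer `Literature/AlgebraicGeometry/Motives`, namespace `Literature.AlgebraicGeometry.Motives.AbelianVariety`.  PROOF FILE (theorems only;
no definition, no named fact, no instance, no `sorry`).

For a complex abelian variety `A` (★ `Motives.AbelianVariety ℂ`), a subgroup `H ≤ A(ℂ)` and a non-empty Zariski-open `U ⊆ A` with
`{P ∈ A(ℂ) | P.pt ∈ U} ⊆ H`: **`H = A(ℂ)`**.  The classical «generation» argument ([SpringerLAG1998] Prop. 2.2.1 (i) «`U·V = G` for dense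
open `U, V` of a connected `G`», [Borel1991] I.2.2): `A` is irreducible (geometrically integral), so for every
`P ∈ A(ℂ)` the open sets `U` and `t_{P⁻¹}⁻¹ U` meet; complex points are Zariski-dense (★ `dense_image_pt_of_dense`, Nullstellensatz), so the
intersection contains a complex point `Q`; then `Q ∈ H` and `P⁻¹Q ∈ H` (its point `t_{P⁻¹}(Q.pt)` lies in `U`, ★ `translation_apply_pt`), whence
`P = Q·(P⁻¹Q)⁻¹ ∈ H`.

* `AbelianVariety.exists_point_pt_mem_inter` — two non-empty opens of `A` share a COMPLEX point.
* `AbelianVariety.subgroup_eq_top_of_forall_mem_of_pt_mem` — the statement above = LETTER (3c) of the G4 sockets v2 (sub-leaf of the crux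
  (g4-3), cell `hodgecm-mathlib`), verbatim; `subgroup_eq_top_of_isOpen` the `A`-explicit spelling.
* `AbelianVariety.eq_one_of_forall_pt_mem` — the form the crux consumes: a homomorphism `h : A(ℂ) →* G` trivial on the complex points of a
  non-empty open is trivial.

COUNT-NEUTRAL: HC_CM is proved only modulo the 7 printed citations until rung 0 closes; this file discharges none of them.

## References
* [SpringerLAG1998] T. A. Springer, *Linear Algebraic Groups*, 2nd ed. (1998), Prop. 2.2.1 (i) (`U·V = G` for dense opens of a connected group).
* [Borel1991] A. Borel, *Linear Algebraic Groups*, 2nd ed. (1991), I.2.2.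
* [GortzWedhorn2020] U. Görtz, T. Wedhorn, *Algebraic Geometry I* (2nd ed. 2020), Prop. 3.35 (closed points are very dense); [GortzWedhorn2023] U. Görtz, T. Wedhorn, *Algebraic Geometry II* (2023), Def. 27.1 (pp. 604–605) (translations).
-/

noncomputable section

open CategoryTheory AlgebraicGeometry Topology

namespace Literature.AlgebraicGeometry.Motives.AbelianVariety

variable (A : AbelianVariety ℂ)

/-- **Two non-empty Zariski-opens of a complex abelian variety share a complex point**: `A` is irreducible (geometrically integral), so
`U ∩ V ≠ ∅`, and the complex points are Zariski-dense (★ `dense_image_pt_of_dense`). [cite: GortzWedhorn2020, Prop. 3.35] -/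
theorem exists_point_pt_mem_inter {U V : Set A.X.left} (hU : IsOpen U) (hV : IsOpen V) (hUne : U.Nonempty) (hVne : V.Nonempty) :
    ∃ Q : A.Points ℂ, Q.pt ∈ U ∧ Q.pt ∈ V := by
  haveI : IsIntegral A.X.left := GeometricallyIntegral.isIntegral_of_subsingleton A.X.hom
  have hUV : (U ∩ V).Nonempty := nonempty_preirreducible_inter hU hV hUne hVne
  have hd : Dense (AlgPoints.pt '' (Set.univ : Set (ComplexPoints A.X))) := dense_image_pt_of_dense dense_univ
  obtain ⟨x, hx, ⟨Q, -, rfl⟩⟩ := hd.inter_open_nonempty (U ∩ V) (hU.inter hV) hUV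
  exact ⟨Q, hx.1, hx.2⟩

/-- `t_{P⁻¹}(t_P(x)) = x` on underlying points. [cite: GortzWedhorn2023, Def. 27.1 (pp. 604–605)] -/
private theorem translation_inv_left_translation_left_apply (P : A.Points ℂ) (x : A.X.left) :
    (A.translation P⁻¹).left ((A.translation P).left x) = x := by
  rw [← Scheme.Hom.comp_apply, ← Over.comp_left, translation_comp_translation_inv]
  rfl

/-- **A subgroup of `A(ℂ)` containing the complex points of a non-empty Zariski-open subset of `A` is all of `A(ℂ)`** — «a non-empty
open subset of an irreducible algebraic group generates it» (LETTER (3c) of the G4 sockets v2, A-p04 (g17) 2026-08-30, verbatim): for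
`P ∈ A(ℂ)` the opens `U` and `t_{P⁻¹}⁻¹ U` share a complex point `Q` (irreducibility + density of complex points), so `Q ∈ H`,
`P⁻¹·Q ∈ H` (its point is `t_{P⁻¹}(Q.pt) ∈ U`, ★ `translation_apply_pt`) and `P = Q·(P⁻¹·Q)⁻¹ ∈ H`.
[cite: SpringerLAG1998, 2.2.1 (i)] [cite: Borel1991, I.2.2] -/
theorem subgroup_eq_top_of_forall_mem_of_pt_mem {A : AbelianVariety ℂ} (H : Subgroup (A.Points ℂ)) (U : A.X.left.Opens)
    (hU : (U : Set A.X.left).Nonempty) (h : ∀ x : A.Points ℂ, x.pt ∈ U → x ∈ H) : H = ⊤ := by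
  rw [eq_top_iff]
  intro P _
  -- the open `t_{P⁻¹}⁻¹ U`
  set V : Set A.X.left := (A.translation P⁻¹).left ⁻¹' (U : Set A.X.left) with hV
  have hVo : IsOpen V := U.isOpen.preimage (A.translation P⁻¹).left.continuous
  have hVne : V.Nonempty := by
    obtain ⟨x, hx⟩ := hU
    refine ⟨(A.translation P).left x, ?_⟩
    show (A.translation P⁻¹).left ((A.translation P).left x) ∈ (U : Set A.X.left)
    rwa [translation_inv_left_translation_left_apply]
  obtain ⟨Q, hQU, hQV⟩ := A.exists_point_pt_mem_inter U.isOpen hVo hU hVne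
  have hQ : Q ∈ H := h Q hQU
  have hPQ : P⁻¹ * Q ∈ H := by
    refine h _ ?_
    show (P⁻¹ * Q).pt ∈ (U : Set A.X.left)
    rw [← translation_apply_pt]
    exact hQV
  have hP : P = Q * (P⁻¹ * Q)⁻¹ := by group
  rw [hP]
  exact H.mul_mem hQ (H.inv_mem hPQ)

/-- The same with `A` explicit and the hypothesis spelled on `(U : Set A)`. [cite: SpringerLAG1998, 2.2.1 (i)] -/
theorem subgroup_eq_top_of_isOpen (H : Subgroup (A.Points ℂ)) (U : A.X.left.Opens) (hU : (U : Set A.X.left).Nonempty)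
    (hHU : ∀ P : A.Points ℂ, P.pt ∈ (U : Set A.X.left) → P ∈ H) : H = ⊤ :=
  subgroup_eq_top_of_forall_mem_of_pt_mem H U hU hHU

/-- **Consumer form: a homomorphism out of `A(ℂ)` which is trivial on the complex points of a non-empty Zariski-open subset is
trivial** (`ker h` is a subgroup containing those points). [cite: SpringerLAG1998, 2.2.1 (i)] -/
theorem eq_one_of_forall_pt_mem {G : Type*} [Group G] (h : A.Points ℂ →* G) (U : A.X.left.Opens)
    (hU : (U : Set A.X.left).Nonempty) (hhU : ∀ P : A.Points ℂ, P.pt ∈ (U : Set A.X.left) → h P = 1) (P : A.Points ℂ) :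
    h P = 1 := by
  have hker : h.ker = ⊤ := A.subgroup_eq_top_of_isOpen h.ker U hU fun Q hQ => (MonoidHom.mem_ker).2 (hhU Q hQ)
  exact (MonoidHom.mem_ker).1 (hker ▸ Subgroup.mem_top P)

/-- **Equality-of-homomorphisms form**: two homomorphisms `A(ℂ) →* G` (`G` commutative) agreeing on the complex points of a
non-empty Zariski-open subset agree everywhere. [cite: SpringerLAG1998, 2.2.1 (i)] -/
theorem monoidHom_eq_of_forall_pt_mem {G : Type*} [CommGroup G] (h h' : A.Points ℂ →* G) (U : A.X.left.Opens)
    (hU : (U : Set A.X.left).Nonempty) (hhU : ∀ P : A.Points ℂ, P.pt ∈ (U : Set A.X.left) → h P = h' P) : h = h' := by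
  refine MonoidHom.ext fun P => ?_
  have key := A.eq_one_of_forall_pt_mem (h / h') U hU (fun Q hQ => by
    rw [MonoidHom.div_apply, hhU Q hQ, div_self']) P
  rwa [MonoidHom.div_apply, div_eq_one] at key

end Literature.AlgebraicGeometry.Motives.AbelianVariety

end
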